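import Mathlib
import Literature.MathematicalPhysics.QuantumFieldTheory.Balaban1983to89.B15ComplexSpaces

/-!
# `Balaban1983to89.B16Eq165Descent` — T. Bałaban, *Large field renormalization. II. Localization, exponentiation, and
bounds for the 𝐑 operation*, Commun. Math. Phys. **122** (1989) 355–392 [Balaban1989LargeFieldII], Sect. 1 p. 375
display **(1.65)** — *"one of the basic points of our construction"*: the extended background `U⁰_k` maps the complex
space `Ũᶜ_k(Y₄, α̃₀, α̃₁)` of the variables `(𝐔, 𝐉)` into the space `Ũ″ᶜ_k(Y₁, α̃₀, α̃₁)` of (1.64)–(1.69) [IV] — TYPED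
(the SKELETON cell read «statement absent»: only its geometry was kernel-checked, in `…B16Stage3Regions`), together
with the p. 375 consequence the paper draws from it (analyticity of `E(X, U⁰_k)` in `(𝐔, 𝐉)`), PROVED as composition

statement-level skeleton of published theorems with citation tags; proofs where landed; nothing here is a claim about
the Yang–Mills mass gap

PDF held: `paper:balaban1989-cmp122-large-field-ii` (journal page = PDF page + 354); [IV] = [Balaban1989LargeFieldI]
(held `paper:balaban1989-cmp122-large-field-i`).  The display and the sentences quoted below were READ AS AN IMAGE by
this seat on the x2 render `run/shared/lean/pub/pub-balaban/b2b-balaban-ref1/pages/1989-cmp122-large-field-II/…-p021-x2.png`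
(p. 375; the superscript of the value space is `″c`, checked on a 2× crop).

CITATION HEADER / WHAT IS REPRODUCED (mega-formalization `lit-balaban`, reader/typer r13 gen 7; HOME
`run/shared/lean/pub/lit-balaban/`, rows `lit-balaban-r13/ROWS-B16.md` v2.21): SKELETON row **B16.Eq1.65** (cell
«typed-existing (geometry only); statement absent»; audit-cell record `pub-balaban/GAPS.md` G-B16-04: *"(1.65) is an
analytic MAP statement on complex (U,J)-neighbourhoods … through the four-stage composite (1.61)∘(1.62)∘(1.63) … It is
load-bearing: the analyticity domains of every new boundary term … rest on it"*, proof in print BY ANALOGY with (1.89)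
[IV]).

WHAT IS PRINTED (p. 375 [PDF 21], verbatim).  *"We obtain the final function of (𝐔, 𝐉), for which the regularity
properties on the domain (Λ˜)ᶜ are almost the same as for the configuration U(𝐁″_k(Y₁), M˙(𝐔)). On the domain Λ˜ the
regularity properties are similar to the properties of the configuration U″_k. A precise description of the regularity
properties is given by the following statement: the extended function U⁰_k described above is an analytic function of
the variables (𝐔, 𝐉) in the space Ũᶜ_k(Y₄, α̃₀, α̃₁), with values in the space Ũ″ᶜ_k(Y₁, α̃₀, α̃₁), i.e.,
(𝐔, 𝐉) ∈ Ũᶜ_k(Y₄, α̃₀, α̃₁) → U⁰_k(𝐔, 𝐉) ∈ Ũ″ᶜ_k(Y₁, α̃₀, α̃₁). (1.65) Let us recall that the last space above, the space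
of values for the function U⁰_k, is the space defined by (1.64)–(1.69) [IV] for n = N. The above statement has been
proved already, in a slightly less general form, in the proof of the equality (1.89) [IV]. The arguments needed for
the proof of (1.65) are almost exactly the same as there; in many places it is enough to replace ε_j by α_{0,j}, or to
make similar simple changes, therefore we do not repeat them here. Let us explain only that the statement (1.65), similar
to the equality (1.89) [IV], is one of the basic points of our construction, and the preliminary integrations of the
previous section were done in order to create a smaller space of values of the function (1.65). In particular, the space
Ũ″ᶜ_k(Y₁, α̃₀, α̃₁) is contained in the analyticity domain of the term 𝐄(X) we consider, hence in the analyticity domains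
of all terms in the obtained effective action. … This implies the basic fact that the function 𝐄(X, U⁰_k) is an analytic
function of the variables (𝐔, 𝐉) on the space Ũᶜ_k(Y₄, α̃₀, α̃₁)."*

HOW IT IS TYPED (the dictionary; all modelling choices are here, ref-1 F6).  `Φ₁` = the carrier of the pairs `(𝐔, 𝐉)`
(complex configurations with currents on the domains of (1.61)–(1.63)), `Φ₂` = the carrier of the values `U⁰_k(𝐔, 𝐉)`
(complex configurations on the fine lattice); `U0k : Φ₁ → Φ₂` = *"the extended function U⁰_k described above"* (the
composite of (1.61), (1.62), (1.63) — rows B16.Eq1.61–1.63, `…B16Sect1AnalyticExt.Repr161/162/163` — written in the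
variables `(𝐔, 𝐉)`; an explicit argument, its construction is not repeated); `S₄ : Set Φ₁` = `Ũᶜ_k(Y₄, α̃₀, α̃₁)` and
`S₁ : Set Φ₂` = `Ũ″ᶜ_k(Y₁, α̃₀, α̃₁)` (the spaces of [III] (2.31) and of (1.64)–(1.69) [IV], `n = N`; their clauses are the
verbatim leaves `…B15.ComplexSpaces.Clause164/166/168`, `Cube165`; here abstract sets, as in `Setup.CplxRegularSpace`).
* §1: **(1.65)** = `Eq165 U0k S₄ S₁ := Set.MapsTo U0k S₄ S₁` (the displayed implication, `eq165_iff`); the full sentence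
  (*"analytic function … in the space …, with values in the space …"*) = `Statement165` over complex normed carriers
  (`AnalyticOnNhd ℂ U0k S₄ ∧ MapsTo U0k S₄ S₁`); the family form over radii-indexed spaces (`Eq165At`).
* §2, PROVED (the use p. 375 makes of (1.65)): `mapsTo_dom_of_eq165` — with `Ũ″ᶜ_k(Y₁, …)` contained in the analyticity
  domain `domE` of `𝐄(X, ·)`, `U⁰_k` maps `Ũᶜ_k(Y₄, …)` into `domE`; **`analyticOnNhd_comp_of_statement165`** — *"the
  function 𝐄(X, U⁰_k) is an analytic function of the variables (𝐔, 𝐉) on the space Ũᶜ_k(Y₄, α̃₀, α̃₁)"* from (1.65), the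
  analyticity of `U⁰_k`, the inclusion, and the analyticity of `𝐄(X, ·)` on its domain (Mathlib `AnalyticOnNhd.comp`);
  the same for every term of a finite effective action (`analyticOnNhd_sum_comp`).
* §3, PROVED (bookkeeping): (1.65) IS a descent statement in the sense of [IV] p. 191 — `eq165_iff_descends`: for one
  carrier and predicates, `Eq165 T {S₁} {S₀} ↔ B15.ComplexSpaces.Descends S₁ S₀ T` (the shape in which *"the above
  statement has been proved already, in a slightly less general form, in the proof of the equality (1.89) [IV]"*; (1.89)
  [IV] itself is `…B15.BasicStep.Claim189`), and (1.65) composes with a further descent of the value space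
  (`eq165_mono_right`, `eq165_comp`).
NOT HERE: the PROOF of (1.65) (print: by analogy with pp. 198–200 of [IV], `ε_j ↦ α_{0,j}`; audit objection G-B16-04
stands), the construction of `U⁰_k(𝐔, 𝐉)` as a composite (rows 1.61–1.63), the clauses of the two spaces (block B15).
No `sorry`, no axiom; nothing printed is asserted as a fact: (1.65) is a `def … : Prop`, and every theorem takes it as a
hypothesis.
-/

open Set

namespace Literature.MathematicalPhysics.QuantumFieldTheory.Balaban1983to89.B16Eq165Descent

/-! ## §1. The statement (1.65) -/

section Statement

variable {Φ₁ Φ₂ : Type*}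

/-- **(1.65)** p. 375 [PDF 21], verbatim: *"the extended function U⁰_k described above is an analytic function of the
variables (𝐔, 𝐉) in the space Ũᶜ_k(Y₄, α̃₀, α̃₁), with values in the space Ũ″ᶜ_k(Y₁, α̃₀, α̃₁), i.e.,
(𝐔, 𝐉) ∈ Ũᶜ_k(Y₄, α̃₀, α̃₁) → U⁰_k(𝐔, 𝐉) ∈ Ũ″ᶜ_k(Y₁, α̃₀, α̃₁). (1.65)"* — the DISPLAYED implication, for the extended
function `U0k` (explicit argument), the space `S₄ = Ũᶜ_k(Y₄, α̃₀, α̃₁)` of its variables and the space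
`S₁ = Ũ″ᶜ_k(Y₁, α̃₀, α̃₁)` ((1.64)–(1.69) [IV], `n = N`) of its values: `U0k` maps `S₄` into `S₁`. A `Prop` (print proves it
by analogy with (1.89) [IV]; not asserted). [cite: Balaban1989LargeFieldII, (1.65) p.375] -/
def Eq165 (U0k : Φ₁ → Φ₂) (S₄ : Set Φ₁) (S₁ : Set Φ₂) : Prop := MapsTo U0k S₄ S₁

/-- (1.65) unfolded: `∀ (𝐔, 𝐉) ∈ Ũᶜ_k(Y₄, α̃₀, α̃₁), U⁰_k(𝐔, 𝐉) ∈ Ũ″ᶜ_k(Y₁, α̃₀, α̃₁)`. [cite: Balaban1989LargeFieldII, (1.65) p.375] -/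
theorem eq165_iff (U0k : Φ₁ → Φ₂) (S₄ : Set Φ₁) (S₁ : Set Φ₂) :
    Eq165 U0k S₄ S₁ ↔ ∀ p ∈ S₄, U0k p ∈ S₁ := Iff.rfl

/-- (1.65) as an inclusion: the image of `Ũᶜ_k(Y₄, …)` under `U⁰_k` lies in `Ũ″ᶜ_k(Y₁, …)` — *"the preliminary integrations
of the previous section were done in order to create a smaller space of values of the function (1.65)"* (p. 375).
[cite: Balaban1989LargeFieldII, (1.65) p.375] -/
theorem eq165_iff_image_subset (U0k : Φ₁ → Φ₂) (S₄ : Set Φ₁) (S₁ : Set Φ₂) :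
    Eq165 U0k S₄ S₁ ↔ U0k '' S₄ ⊆ S₁ := mapsTo_iff_image_subset

/-- The radii-indexed form: spaces `Ũᶜ_k(X, α̃₀, α̃₁)`, `Ũ″ᶜ_k(X, α̃₀, α̃₁)` as families of sets indexed by a localization
domain and the two radii (as the tree's `Setup.CplxRegularSpace` for the three-radii spaces of [I]), and (1.65) at the
printed arguments `(Y₄; Y₁; α̃₀, α̃₁)` — the SAME radii on both sides, the domain shrinking from `Y₄` to `Y₁`.
[cite: Balaban1989LargeFieldII, (1.65) p.375] -/
def Eq165At {Dom₁ Dom₂ : Type*} (Ut : Dom₁ → ℝ → ℝ → Set Φ₁) (UtPP : Dom₂ → ℝ → ℝ → Set Φ₂) (U0k : Φ₁ → Φ₂)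
    (Y₄ : Dom₁) (Y₁ : Dom₂) (a₀ a₁ : ℝ) : Prop :=
  Eq165 U0k (Ut Y₄ a₀ a₁) (UtPP Y₁ a₀ a₁)

/-- `Eq165At` is (1.65) at the two printed spaces. [cite: Balaban1989LargeFieldII, (1.65) p.375] -/
theorem eq165At_iff {Dom₁ Dom₂ : Type*} (Ut : Dom₁ → ℝ → ℝ → Set Φ₁) (UtPP : Dom₂ → ℝ → ℝ → Set Φ₂)
    (U0k : Φ₁ → Φ₂) (Y₄ : Dom₁) (Y₁ : Dom₂) (a₀ a₁ : ℝ) :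
    Eq165At Ut UtPP U0k Y₄ Y₁ a₀ a₁ ↔ ∀ p ∈ Ut Y₄ a₀ a₁, U0k p ∈ UtPP Y₁ a₀ a₁ := Iff.rfl

end Statement

section Analytic

variable {Φ₁ Φ₂ : Type*} [NormedAddCommGroup Φ₁] [NormedSpace ℂ Φ₁] [NormedAddCommGroup Φ₂] [NormedSpace ℂ Φ₂]

/-- The full p. 375 sentence, over complex normed carriers of the configurations: *"the extended function U⁰_k … is an
analytic function of the variables (𝐔, 𝐉) in the space Ũᶜ_k(Y₄, α̃₀, α̃₁), with values in the space Ũ″ᶜ_k(Y₁, α̃₀, α̃₁)"*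
— analyticity of `U0k` at every point of `S₄` (Mathlib `AnalyticOnNhd ℂ`) AND (1.65). A `Prop`. [cite: Balaban1989LargeFieldII, (1.65) p.375] -/
def Statement165 (U0k : Φ₁ → Φ₂) (S₄ : Set Φ₁) (S₁ : Set Φ₂) : Prop :=
  AnalyticOnNhd ℂ U0k S₄ ∧ Eq165 U0k S₄ S₁

/-- The sentence contains the display. [cite: Balaban1989LargeFieldII, (1.65) p.375] -/
theorem Statement165.eq165 {U0k : Φ₁ → Φ₂} {S₄ : Set Φ₁} {S₁ : Set Φ₂} (h : Statement165 U0k S₄ S₁) :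
    Eq165 U0k S₄ S₁ := h.2

end Analytic

/-! ## §2. What p. 375 draws from (1.65): the terms `𝐄(X, U⁰_k)` are analytic in `(𝐔, 𝐉)` -/

section Consequence

variable {Φ₁ Φ₂ : Type*}

/-- p. 375: *"In particular, the space Ũ″ᶜ_k(Y₁, α̃₀, α̃₁) is contained in the analyticity domain of the term 𝐄(X) we
consider, hence in the analyticity domains of all terms in the obtained effective action"* (`hdom`) — with (1.65), the
extended function maps `Ũᶜ_k(Y₄, …)` INTO that analyticity domain, so `𝐄(X, U⁰_k(𝐔, 𝐉))` is defined there. PROVED.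
[cite: Balaban1989LargeFieldII, (1.65) p.375] -/
theorem mapsTo_dom_of_eq165 {U0k : Φ₁ → Φ₂} {S₄ : Set Φ₁} {S₁ domE : Set Φ₂} (h165 : Eq165 U0k S₄ S₁)
    (hdom : S₁ ⊆ domE) : MapsTo U0k S₄ domE :=
  h165.mono_right hdom

variable [NormedAddCommGroup Φ₁] [NormedSpace ℂ Φ₁] [NormedAddCommGroup Φ₂] [NormedSpace ℂ Φ₂]
variable {W : Type*} [NormedAddCommGroup W] [NormedSpace ℂ W]

/-- p. 375, the conclusion: *"This implies the basic fact that the function 𝐄(X, U⁰_k) is an analytic function of the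
variables (𝐔, 𝐉) on the space Ũᶜ_k(Y₄, α̃₀, α̃₁)."* — PROVED from the p. 375 sentence (`Statement165`: `U⁰_k` analytic on
`Ũᶜ_k(Y₄, …)` with values in `Ũ″ᶜ_k(Y₁, …)`), the inclusion of `Ũ″ᶜ_k(Y₁, …)` in the analyticity domain `domE` of the term
(`hdom`) and the analyticity of `𝐄(X, ·)` there (`hE`, the inductive assumption (1.70) [IV] / (1.67) for the term), by the
chain rule for analytic maps (Mathlib `AnalyticOnNhd.comp`). [cite: Balaban1989LargeFieldII, (1.65) p.375] -/
theorem analyticOnNhd_comp_of_statement165 {U0k : Φ₁ → Φ₂} {S₄ : Set Φ₁} {S₁ domE : Set Φ₂} {E : Φ₂ → W}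
    (h : Statement165 U0k S₄ S₁) (hdom : S₁ ⊆ domE) (hE : AnalyticOnNhd ℂ E domE) :
    AnalyticOnNhd ℂ (E ∘ U0k) S₄ :=
  hE.comp h.1 (mapsTo_dom_of_eq165 h.2 hdom)

/-- The same for *"all terms in the obtained effective action"*: a finite sum `Σ_{X∈𝒳} 𝐄(X, U⁰_k(𝐔, 𝐉))` of terms each
analytic on a domain containing `Ũ″ᶜ_k(Y₁, …)` is analytic in `(𝐔, 𝐉)` on `Ũᶜ_k(Y₄, …)`. PROVED. [cite: Balaban1989LargeFieldII, (1.65) p.375] -/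
theorem analyticOnNhd_sum_comp {ι : Type*} (𝒳 : Finset ι) {U0k : Φ₁ → Φ₂} {S₄ : Set Φ₁} {S₁ : Set Φ₂}
    {domE : ι → Set Φ₂} {E : ι → Φ₂ → W} (h : Statement165 U0k S₄ S₁) (hdom : ∀ X ∈ 𝒳, S₁ ⊆ domE X)
    (hE : ∀ X ∈ 𝒳, AnalyticOnNhd ℂ (E X) (domE X)) :
    AnalyticOnNhd ℂ (fun p => ∑ X ∈ 𝒳, E X (U0k p)) S₄ := by
  have hterm : ∀ X ∈ 𝒳, AnalyticOnNhd ℂ (fun p => E X (U0k p)) S₄ := fun X hX =>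
    analyticOnNhd_comp_of_statement165 h (hdom X hX) (hE X hX)
  have hsum := Finset.analyticOnNhd_sum 𝒳 hterm
  rwa [Finset.sum_fn] at hsum

end Consequence

/-! ## §3. (1.65) is a descent statement in the sense of [IV] p. 191 -/

section Descent

open B15.ComplexSpaces

variable {C : Type*}

/-- For one carrier and membership predicates, (1.65) IS the descent shape of [IV] p. 191 (`B15.ComplexSpaces.Descends
S₁ S₀ T`: membership in `S₁` implies membership of the image under `T` in `S₀`) — the shape in which *"the above statement
has been proved already, in a slightly less general form, in the proof of the equality (1.89) [IV]"* (p. 375; (1.89) [IV]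
is `…B15.BasicStep.Claim189`). Bookkeeping. [cite: Balaban1989LargeFieldII, (1.65) p.375] -/
theorem eq165_iff_descends (T : C → C) (S₁ S₀ : C → Prop) :
    Eq165 T {x | S₁ x} {x | S₀ x} ↔ Descends S₁ S₀ T := Iff.rfl

/-- Shrinking the value space is free: (1.65) with values in `S₁` and `S₁ ⊆ S₁'` give (1.65) with values in `S₁'` — the
direction in which p. 375 uses *"a smaller space of values"*. PROVED. [cite: Balaban1989LargeFieldII, (1.65) p.375] -/
theorem eq165_mono_right {Φ₁ Φ₂ : Type*} {U0k : Φ₁ → Φ₂} {S₄ : Set Φ₁} {S₁ S₁' : Set Φ₂} (h : Eq165 U0k S₄ S₁)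
    (hsub : S₁ ⊆ S₁') : Eq165 U0k S₄ S₁' :=
  MapsTo.mono_right h hsub

/-- Enlarging the space of variables is not free but restricting it is: (1.65) on `S₄` gives (1.65) on every `S₄' ⊆ S₄`.
PROVED. [cite: Balaban1989LargeFieldII, (1.65) p.375] -/
theorem eq165_mono_left {Φ₁ Φ₂ : Type*} {U0k : Φ₁ → Φ₂} {S₄ S₄' : Set Φ₁} {S₁ : Set Φ₂} (h : Eq165 U0k S₄ S₁)
    (hsub : S₄' ⊆ S₄) : Eq165 U0k S₄' S₁ :=
  MapsTo.mono_left h hsub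

/-- (1.65) composes with a further map of the value space (e.g. a descent `Ũ″ᶜ_k → Ũ^{(n)c}_k` of [IV] p. 191, or the
averaging `M˙(·)` into the analyticity domain of a term): `MapsTo` composition. PROVED. [cite: Balaban1989LargeFieldII, (1.65) p.375] -/
theorem eq165_comp {Φ₁ Φ₂ Φ₃ : Type*} {U0k : Φ₁ → Φ₂} {T : Φ₂ → Φ₃} {S₄ : Set Φ₁} {S₁ : Set Φ₂} {S₀ : Set Φ₃}
    (h : Eq165 U0k S₄ S₁) (hT : MapsTo T S₁ S₀) : Eq165 (T ∘ U0k) S₄ S₀ :=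
  hT.comp h

end Descent

end Literature.MathematicalPhysics.QuantumFieldTheory.Balaban1983to89.B16Eq165Descent
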